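import Summits.AtomisticToContinuum.Crystallization.Theorems.FrustratedLawDichotomyStrainedPatchHomSignedWellA
import Summits.AtomisticToContinuum.Crystallization.Theorems.FrustratedLawDichotomyStrainedPatchHomXiElimL
import Summits.AtomisticToContinuum.Crystallization.Theorems.FrustratedLawDichotomyStrainedPatchHomShearFrames

/-!
# SIGNED, BOX-CONSTRAINED ξ-ELIMINATION («SignedXiElim»), part B: the diameter bookkeeping and the kernel-facing consumers
# (cell decomp-a2c, lens-5 g106; crux `AperiodicFrustratedLawGap`, stmt-AtomisticToContinuum-27623, `(H∣E-zone)` E-piece NEAR boxes; critic rows 1646 (F5),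
# 1647 (E4), 1652 (L1)(L2)(L6); sequel of `…HomSignedWellA`)

Part A proved the SIGNED box floor `V − G·D + (min λ 0/2)·D² ≤ Σ_b W₄₅‖latPt U hexFrame b + U(hcpShift + ξ)‖` for `‖U(ξ − ξ₀)‖ ≤ D`
(`hcpShifted_boxFloor_W45`, any real `λ`).  This part supplies the diameter `D` in the three currencies in use and the consumers:

* §4 `D`: `‖U v‖ ≤ (1 + ε)‖v‖` (`norm_apply_le_of_norm_sub_one_le`; the `5/4` case is `…TaylorLattice.norm_apply_le_of_near_one`), two balls around one
  track value (`norm_map_sub_le_of_balls`: FIXED reference `ξ₀` at drift `r₀` from the track, `D = (5/4)(r + r₀)`), the ζ-CENTRED reference `ξ₀ = x`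
  (`norm_map_sub_le_of_ball`: `D = (5/4)r`, no drift term), the track-norm helper `norm_track_le`, two coordinate boxes (`norm_map_sub_le_of_cubes`, via
  `…HomShearFrames.norm_sub_sq_le_of_cube`) and the INTEGER CHECK form in `SC` units (`norm_map_sub_le_of_intBoxes`: `25·Σ_i (w_i + w₀_i + |c_i − c₀_i|)² ≤ 16·Ds²`);
* §5 ★★★ `hcpEnergy_of_xiElimL2_signed` — `…HomXiElimL.hcpEnergy_of_xiElimL2` VERBATIM but WITHOUT `0 < lamS` (plus `0 ≤ Gs` and the integer diameter
  check), so the EXISTING cube leaves `slopeCheck2` / `curvCheckL2` certify near boxes at `lamS ≤ 0`; ★★ the BALL forms in the LOEW / ShearFrames currency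
  with abstract leaves: `hcpShifted_ballFloor_W45` (reference `ξ₀ ∈ B(x, r₀)`, target `ξ ∈ B(x, r)`) and the ζ-centred uniform packaging
  `hcpEnergy_of_ballLeaves_signed` (value AT the track `σ U`, slope at `σ U`, curvature floor of any sign on the ball; one entry per `U`-box — the `hE_B`
  producer shape of `…HomShearFrames.homFloorHcp_of_piecewiseSheet_boxes` up to the energy → ball-average step of the value leaf);
* §6 numeric witnesses of the budget claims at the record radius `r = 3/400`, `m = 1/625` (`norm_num`): curvature loss `≤ 0.032 m` (ζ-centred) /
  `≤ 0.063 m` (drift `3/1000`) at `|λ| = 231/200`; slope budget of the tightest near frame `G ≤ 9/200`; the box floor beating complete-the-square at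
  `λ = 3/5`, `G = 9/200`.

Def-free; 0 sorry; standard axioms; no `set_option` / instances / notation / `#eval`.  `--supports stmt-AtomisticToContinuum-27623 --as helper`.
[folklore; formal bookkeeping]
-/

noncomputable section

namespace Summit.AtomisticToContinuum.Crystallization.Theorems.FrustratedLawDichotomyStrainedPatchHomSignedWell

open scoped BigOperators
open Literature.Analysis.ValidatedNumerics.Numerics
open Summit.AtomisticToContinuum.Crystallization.Theorems.ChargedEnergyGapNegative (E3)
open Summit.AtomisticToContinuum.Crystallization.Theorems.FrustratedLawDichotomySchurCut (effPot w₄₅ ω₄)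
open Summit.AtomisticToContinuum.Crystallization.Theorems.FrustratedLawDichotomyStrainedPatchTaylorChord (segR segG segGd)
open Summit.AtomisticToContinuum.Crystallization.Theorems.FrustratedLawDichotomyStrainedPatchHomSplit (latPt hexFrame hcpShift)
open Summit.AtomisticToContinuum.Crystallization.Theorems.FrustratedLawDichotomyStrainedPatchEnvelopeTaylor (Wrec)
open Summit.AtomisticToContinuum.Crystallization.Theorems.FrustratedLawDichotomyStrainedPatchTaylorLeaves (junctions)
open Summit.AtomisticToContinuum.Crystallization.Theorems.FrustratedLawDichotomyStrainedPatchHomCurvLeaf (slopeCheck2 slope_bound_of_slopeCheck2)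
open Summit.AtomisticToContinuum.Crystallization.Theorems.FrustratedLawDichotomyStrainedPatchHomCurvLeafL2 (curvCheckL2 curv_floor_of_curvCheckL2)
open Summit.AtomisticToContinuum.Crystallization.Theorems.FrustratedLawDichotomyStrainedPatchHomShearFrames (norm_sub_sq_le_of_cube)
open Summit.AtomisticToContinuum.Crystallization.Theorems.FrustratedLawDichotomyStrainedPatchHomPolar (norm_apply_le_of_norm_sub_one_le)

/-! ## §4. The diameter `D`: balls around a track value, the ζ-centred reference, coordinate boxes -/

-- LANE EDITION (hand-2 g44, gate `dedup.landed`): the node's `norm_apply_le_of_norm_sub_one_le` restates the landed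
-- `…StrainedPatchHomPolar.norm_apply_le_of_norm_sub_one_le` (identical statement); dropped here; the tree lemma is cited by the `open … (norm_apply_le_of_norm_sub_one_le)` above.

/-- ★ **TWO BALLS AROUND ONE TRACK VALUE**: `‖U − 1‖ ≤ 1/4`, target `‖ξ − x‖ ≤ r`, reference `‖ξ₀ − x‖ ≤ r₀` ⟹ `‖U(ξ − ξ₀)‖ ≤ (5/4)(r + r₀)` — the
diameter `D` for a FIXED reference shuffle `ξ₀` (e.g. `cenShuf c`) at drift `r₀` from the frame track `x = σ(U)`. [triangle inequality] -/
theorem norm_map_sub_le_of_balls {U : E3 →L[ℝ] E3} (hU : ‖U - 1‖ ≤ 1 / 4) {ξ ξ₀ x : E3} {r r₀ : ℝ} (hξ : ‖ξ - x‖ ≤ r)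
    (hξ₀ : ‖ξ₀ - x‖ ≤ r₀) : ‖U (ξ - ξ₀)‖ ≤ 5 / 4 * (r + r₀) := by
  have h1 := norm_apply_le_of_norm_sub_one_le hU (ξ - ξ₀)
  have h2 : ‖ξ - ξ₀‖ ≤ r + r₀ := by
    calc ‖ξ - ξ₀‖ = ‖(ξ - x) - (ξ₀ - x)‖ := by congr 1; abel
      _ ≤ ‖ξ - x‖ + ‖ξ₀ - x‖ := norm_sub_le _ _
      _ ≤ r + r₀ := by linarith
  nlinarith [norm_nonneg (ξ - ξ₀)]

/-- ★ **THE ζ-CENTRED REFERENCE** `ξ₀ = x` (reference AT the track value; no drift term): `‖ξ − x‖ ≤ r ⟹ ‖U(ξ − x)‖ ≤ (5/4)r`. [special case] -/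
theorem norm_map_sub_le_of_ball {U : E3 →L[ℝ] E3} (hU : ‖U - 1‖ ≤ 1 / 4) {ξ x : E3} {r : ℝ} (hξ : ‖ξ - x‖ ≤ r) :
    ‖U (ξ - x)‖ ≤ 5 / 4 * r := by
  have h := norm_map_sub_le_of_balls hU hξ (ξ₀ := x) (r₀ := 0) (by simp)
  simpa using h

/-- The track value inherits a norm bound from any admissible shuffle of its ball: `‖ξ − x‖ ≤ r`, `‖ξ‖ ≤ ρ ⟹ ‖x‖ ≤ ρ + r` (so `ρ = 1/8`,
`r ≤ 1/8` give the `‖ξ₀‖ ≤ 1/4` input of §3 for the ζ-centred reference). [triangle inequality] -/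
theorem norm_track_le {ξ x : E3} {r ρ : ℝ} (hξ : ‖ξ - x‖ ≤ r) (hn : ‖ξ‖ ≤ ρ) : ‖x‖ ≤ ρ + r := by
  have : ‖x‖ ≤ ‖ξ‖ + ‖ξ - x‖ := by
    calc ‖x‖ = ‖ξ - (ξ - x)‖ := by congr 1; abel
      _ ≤ ‖ξ‖ + ‖ξ - x‖ := norm_sub_le _ _
  linarith

/-- ★ **TWO COORDINATE BOXES**: `|ξ_i − a_i| ≤ h_i`, `|ξ₀_i − a₀_i| ≤ h₀_i`, `‖U − 1‖ ≤ 1/4`, and `(25/16)·Σ_i (h_i + h₀_i + |a_i − a₀_i|)² ≤ D²` with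
`0 ≤ D` ⟹ `‖U(ξ − ξ₀)‖ ≤ D`. [`…HomShearFrames.norm_sub_sq_le_of_cube` + triangle inequality] -/
theorem norm_map_sub_le_of_cubes {U : E3 →L[ℝ] E3} (hU : ‖U - 1‖ ≤ 1 / 4) {ξ ξ₀ : E3} {a h a₀ h₀ : Fin 3 → ℝ}
    (hξ : ∀ i, |ξ i - a i| ≤ h i) (hξ₀ : ∀ i, |ξ₀ i - a₀ i| ≤ h₀ i) {D : ℝ} (hD0 : 0 ≤ D)
    (hD : (25 / 16 : ℝ) * ∑ i, (h i + h₀ i + |a i - a₀ i|) ^ 2 ≤ D ^ 2) : ‖U (ξ - ξ₀)‖ ≤ D := by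
  have hcube : ∀ i, |ξ i - ξ₀ i| ≤ h i + h₀ i + |a i - a₀ i| := by
    intro i
    calc |ξ i - ξ₀ i| = |(ξ i - a i) + (a i - a₀ i) - (ξ₀ i - a₀ i)| := by ring_nf
      _ ≤ |(ξ i - a i) + (a i - a₀ i)| + |ξ₀ i - a₀ i| := abs_sub _ _
      _ ≤ |ξ i - a i| + |a i - a₀ i| + |ξ₀ i - a₀ i| := by gcongr; exact abs_add_le _ _
      _ ≤ h i + h₀ i + |a i - a₀ i| := by linarith [hξ i, hξ₀ i]
  have hsq := norm_sub_sq_le_of_cube hcube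
  have h1 := norm_apply_le_of_norm_sub_one_le hU (ξ - ξ₀)
  have h5 : 0 ≤ (5 / 4 : ℝ) * ‖ξ - ξ₀‖ := by positivity
  have hsq' : ((5 / 4 : ℝ) * ‖ξ - ξ₀‖) ^ 2 ≤ D ^ 2 := by nlinarith
  have hle : (5 / 4 : ℝ) * ‖ξ - ξ₀‖ ≤ D := (sq_le_sq₀ h5 hD0).1 hsq'
  linarith

/-- ★ **INTEGER CHECK FORM** (the box currency of the cube leaves, `SC` units): target box `(c, w)`, reference box `(c₀, w₀)` on the shuffle
coordinates, `0 ≤ Ds` and `25·Σ_i (w_i + w₀_i + |c_i − c₀_i|)² ≤ 16·Ds²` (decidable on literals) ⟹ `‖U(ξ − ξ₀)‖ ≤ Ds/SC`. [formal bookkeeping] -/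
theorem norm_map_sub_le_of_intBoxes {U : E3 →L[ℝ] E3} (hU : ‖U - 1‖ ≤ 1 / 4) {c w c₀ w₀ : (Fin 3 × Fin 3) ⊕ Fin 3 → ℤ} {ξ ξ₀ : E3}
    (hξ : ∀ i : Fin 3, |ξ i - (c (Sum.inr i) : ℝ) / SC| ≤ (w (Sum.inr i) : ℝ) / SC)
    (hξ₀ : ∀ i : Fin 3, |ξ₀ i - (c₀ (Sum.inr i) : ℝ) / SC| ≤ (w₀ (Sum.inr i) : ℝ) / SC) {Ds : ℤ} (hDs0 : 0 ≤ Ds)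
    (hDs : 25 * ∑ i : Fin 3, (w (Sum.inr i) + w₀ (Sum.inr i) + |c (Sum.inr i) - c₀ (Sum.inr i)|) ^ 2 ≤ 16 * Ds ^ 2) :
    ‖U (ξ - ξ₀)‖ ≤ (Ds : ℝ) / SC := by
  have hS : (0 : ℝ) < SC := by norm_num [SC]
  have hcast : (25 : ℝ) * ∑ i : Fin 3, ((w (Sum.inr i) : ℝ) + (w₀ (Sum.inr i) : ℝ) + |(c (Sum.inr i) : ℝ) - (c₀ (Sum.inr i) : ℝ)|) ^ 2 ≤
      16 * (Ds : ℝ) ^ 2 := by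
    exact_mod_cast hDs
  refine norm_map_sub_le_of_cubes hU hξ hξ₀ (div_nonneg (by exact_mod_cast hDs0) hS.le) ?_
  have hterm : ∀ i : Fin 3, ((w (Sum.inr i) : ℝ) / SC + (w₀ (Sum.inr i) : ℝ) / SC + |(c (Sum.inr i) : ℝ) / SC - (c₀ (Sum.inr i) : ℝ) / SC|) ^ 2 =
      ((w (Sum.inr i) : ℝ) + (w₀ (Sum.inr i) : ℝ) + |(c (Sum.inr i) : ℝ) - (c₀ (Sum.inr i) : ℝ)|) ^ 2 / (SC : ℝ) ^ 2 := by
    intro i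
    rw [← sub_div, abs_div, abs_of_pos hS]
    field_simp
  rw [Finset.sum_congr rfl fun i _ => hterm i, ← Finset.sum_div, div_pow]
  rw [show (25 / 16 : ℝ) * ((∑ i : Fin 3, ((w (Sum.inr i) : ℝ) + (w₀ (Sum.inr i) : ℝ) + |(c (Sum.inr i) : ℝ) - (c₀ (Sum.inr i) : ℝ)|) ^ 2) /
      (SC : ℝ) ^ 2) = ((25 : ℝ) * ∑ i : Fin 3, ((w (Sum.inr i) : ℝ) + (w₀ (Sum.inr i) : ℝ) + |(c (Sum.inr i) : ℝ) - (c₀ (Sum.inr i) : ℝ)|) ^ 2) /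
      (16 * (SC : ℝ) ^ 2) by ring]
  rw [div_le_div_iff₀ (by positivity) (by positivity)]
  nlinarith [hcast, sq_nonneg (SC : ℝ)]

/-! ## §5. Kernel-facing consumers -/

/-- ★★★ **SIGNED ξ-ELIMINATION FOR THE hcp ENERGY SUM WITH THE CENTRED CURVATURE LEAF** — `…HomXiElimL.hcpEnergy_of_xiElimL2` VERBATIM but WITHOUT
`0 < lamS`: boxes `(c₀, w₀)` = `U`-box × reference shuffle box ⊆ `(c, w)` = the same `U`-box × target shuffle box, label list `Lc ++ Ln` duplicate-free,
value floor `V₀` on the reference box, `slopeCheck2 c₀ w₀ (Lc ++ Ln) Gs` with `0 ≤ Gs`, `curvCheckL2 c w Lc Ln lamS` with `lamS : ℤ` OF ANY SIGN, and the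
integer diameter check `25·Σ_i (w_i + w₀_i + |c_i − c₀_i|)² ≤ 16·Ds²` (`0 ≤ Ds`) ⟹ for every `U` of the box with `‖U − 1‖ ≤ 1/4` and every target shuffle
`ξ` (`‖ξ‖ ≤ 1/4`), given one reference shuffle `ξ₀` (`‖ξ₀‖ ≤ 1/4`):
`V₀ − (Gs/SC)(Ds/SC) + (min (lamS/SC) 0 / 2)(Ds/SC)² ≤ Σ_A(U) + Σ_{b ∈ Lc ++ Ln} W₄₅‖latPt U hexFrame b + U(hcpShift + ξ)‖`.
[folklore chaining: `hcpShifted_boxFloor_W45` + the tree's leaf soundness theorems] -/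
theorem hcpEnergy_of_xiElimL2_signed {c₀ w₀ c w : (Fin 3 × Fin 3) ⊕ Fin 3 → ℤ}
    (hsame : ∀ ab : Fin 3 × Fin 3, c₀ (Sum.inl ab) = c (Sum.inl ab) ∧ w₀ (Sum.inl ab) = w (Sum.inl ab))
    (hsub : ∀ (i : Fin 3) (x : ℝ), |x - (c₀ (Sum.inr i) : ℝ) / SC| ≤ (w₀ (Sum.inr i) : ℝ) / SC → |x - (c (Sum.inr i) : ℝ) / SC| ≤ (w (Sum.inr i) : ℝ) / SC)
    {Lc Ln : List (Fin 3 → ℤ)} (hL : (Lc ++ Ln).Nodup) {Gs lamS Ds : ℤ} (hGs : 0 ≤ Gs) (hDs0 : 0 ≤ Ds)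
    (hDs : 25 * ∑ i : Fin 3, (w (Sum.inr i) + w₀ (Sum.inr i) + |c (Sum.inr i) - c₀ (Sum.inr i)|) ^ 2 ≤ 16 * Ds ^ 2)
    (hslope : slopeCheck2 c₀ w₀ (Lc ++ Ln) Gs = true) (hcurv : curvCheckL2 c w Lc Ln lamS = true)
    (SA : (E3 →L[ℝ] E3) → ℝ) {V₀ : ℝ}
    (hval : ∀ (U : E3 →L[ℝ] E3) (ξ₀ : E3), ‖U - 1‖ ≤ 1 / 4 →
      (∀ ab : Fin 3 × Fin 3, |(U (EuclideanSpace.single ab.2 (1 : ℝ))) ab.1 - (c₀ (Sum.inl ab) : ℝ) / SC| ≤ (w₀ (Sum.inl ab) : ℝ) / SC) →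
      (∀ i : Fin 3, |ξ₀ i - (c₀ (Sum.inr i) : ℝ) / SC| ≤ (w₀ (Sum.inr i) : ℝ) / SC) → ‖ξ₀‖ ≤ 1 / 4 →
      V₀ ≤ SA U + ∑ b ∈ (Lc ++ Ln).toFinset, effPot w₄₅ ω₄ (3 / 400) ‖latPt U hexFrame b + U (hcpShift + ξ₀)‖)
    (U : E3 →L[ℝ] E3) (hU : ‖U - 1‖ ≤ 1 / 4)
    (hbox : ∀ ab : Fin 3 × Fin 3, |(U (EuclideanSpace.single ab.2 (1 : ℝ))) ab.1 - (c (Sum.inl ab) : ℝ) / SC| ≤ (w (Sum.inl ab) : ℝ) / SC)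
    (ξ₀ : E3) (hξ₀ : ∀ i : Fin 3, |ξ₀ i - (c₀ (Sum.inr i) : ℝ) / SC| ≤ (w₀ (Sum.inr i) : ℝ) / SC) (hn₀ : ‖ξ₀‖ ≤ 1 / 4)
    (ξ : E3) (hξ : ∀ i : Fin 3, |ξ i - (c (Sum.inr i) : ℝ) / SC| ≤ (w (Sum.inr i) : ℝ) / SC) (hn : ‖ξ‖ ≤ 1 / 4) :
    V₀ - (Gs : ℝ) / SC * ((Ds : ℝ) / SC) + min ((lamS : ℝ) / SC) 0 / 2 * ((Ds : ℝ) / SC) ^ 2 ≤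
      SA U + ∑ b ∈ (Lc ++ Ln).toFinset, effPot w₄₅ ω₄ (3 / 400) ‖latPt U hexFrame b + U (hcpShift + ξ)‖ := by
  have hS : (0 : ℝ) < SC := by norm_num [SC]
  have hG₀ : (0 : ℝ) ≤ (Gs : ℝ) / SC := div_nonneg (by exact_mod_cast hGs) hS.le
  have hbox₀ : ∀ ab : Fin 3 × Fin 3, |(U (EuclideanSpace.single ab.2 (1 : ℝ))) ab.1 - (c₀ (Sum.inl ab) : ℝ) / SC| ≤ (w₀ (Sum.inl ab) : ℝ) / SC := by
    intro ab; rw [(hsame ab).1, (hsame ab).2]; exact hbox ab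
  have hξ₀' : ∀ i : Fin 3, |ξ₀ i - (c (Sum.inr i) : ℝ) / SC| ≤ (w (Sum.inr i) : ℝ) / SC := fun i => hsub i _ (hξ₀ i)
  have hV := hval U ξ₀ hU hbox₀ hξ₀ hn₀
  have hG := slope_bound_of_slopeCheck2 hL hslope U hU hbox₀ ξ₀ hξ₀ hn₀ ξ
  have hD := norm_map_sub_le_of_intBoxes hU hξ hξ₀ hDs0 hDs
  have hV' : V₀ - SA U ≤ ∑ b ∈ (Lc ++ Ln).toFinset, Wrec ‖latPt U hexFrame b + U (hcpShift + ξ₀)‖ := by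
    unfold Wrec; linarith
  have key := hcpShifted_boxFloor_W45 (Lc ++ Ln).toFinset hU hn₀ hn hG₀
    (fun s hs hgood => curv_floor_of_curvCheckL2 hL hcurv U hU hbox ξ₀ ξ hξ₀' hξ hn₀ hn hs hgood) hV' hG hD
  unfold Wrec at key
  linarith

/-- ★★ **BALL FLOOR FOR THE hcp SHIFTED-FAMILY SUM OF `W₄₅`** (LOEW / ShearFrames currency): reference `ξ₀ ∈ B(x, r₀)`, target `ξ ∈ B(x, r)` around one
track value `x` (`= σ(U)`), `‖U − 1‖ ≤ 1/4`, `‖ξ₀‖, ‖ξ‖ ≤ 1/4`, `0 ≤ G`, ANY REAL `λ` ⟹ with `D = (5/4)(r + r₀)`: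
`V − G·D + (min λ 0/2)·D² ≤ Σ_b W₄₅‖latPt U hexFrame b + U(hcpShift + ξ)‖`. [`hcpShifted_boxFloor_W45` + `norm_map_sub_le_of_balls`] -/
theorem hcpShifted_ballFloor_W45 (B : Finset (Fin 3 → ℤ)) {U : E3 →L[ℝ] E3} (hU : ‖U - 1‖ ≤ 1 / 4) {x ξ₀ ξ : E3} {r₀ r : ℝ}
    (hξ₀x : ‖ξ₀ - x‖ ≤ r₀) (hξx : ‖ξ - x‖ ≤ r) (hξ₀ : ‖ξ₀‖ ≤ 1 / 4) (hξ : ‖ξ‖ ≤ 1 / 4) {lam G V : ℝ} (hG₀ : 0 ≤ G)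
    (hcurv : ∀ s ∈ Set.Ioo (0 : ℝ) 1,
      (∀ bb ∈ B, segR (latPt U hexFrame bb + U (hcpShift + ξ₀)) (U (ξ - ξ₀)) s ∉ junctions) →
      lam * ‖U (ξ - ξ₀)‖ ^ 2 ≤ ∑ bb ∈ B, segGd (deriv Wrec) (latPt U hexFrame bb + U (hcpShift + ξ₀)) (U (ξ - ξ₀)) s)
    (hV : V ≤ ∑ bb ∈ B, Wrec ‖latPt U hexFrame bb + U (hcpShift + ξ₀)‖)
    (hG : |∑ bb ∈ B, segG (deriv Wrec) (latPt U hexFrame bb + U (hcpShift + ξ₀)) (U (ξ - ξ₀)) 0| ≤ G * ‖U (ξ - ξ₀)‖) :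
    V - G * (5 / 4 * (r + r₀)) + min lam 0 / 2 * (5 / 4 * (r + r₀)) ^ 2 ≤ ∑ bb ∈ B, Wrec ‖latPt U hexFrame bb + U (hcpShift + ξ)‖ :=
  hcpShifted_boxFloor_W45 B hU hξ₀ hξ hG₀ hcurv hV hG (norm_map_sub_le_of_balls hU hξx hξ₀x)

/-- ★★★ **ζ-CENTRED UNIFORM PACKAGING** (one entry per `U`-box, the E-piece NEAR design): a box predicate `Zb`, a track `σ`, tube radius `r`, any label
finset `B`, an `A`-family term `SA`, and three leaves uniform over the box — VALUE AT THE TRACK `V₀ ≤ SA U + Σ_b W₄₅‖latPt U b + U(hcpShift + σ U)‖`,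
SLOPE AT THE TRACK `|Σ_b segG W₄₅′ p_b(U, σ U) (U(ξ − σ U)) 0| ≤ G‖U(ξ − σ U)‖` (`0 ≤ G`), CURVATURE-SUM floor `λ` OF ANY SIGN on the ball — give, for every
`U ∈ Zb` with `‖U − 1‖ ≤ 1/4`, `‖σ U‖ ≤ 1/4` and every `ξ` with `‖ξ − σ U‖ ≤ r`, `‖ξ‖ ≤ 1/4`:
`V₀ − G·(5r/4) + (min λ 0/2)(5r/4)² ≤ SA U + Σ_b W₄₅‖latPt U hexFrame b + U(hcpShift + ξ)‖` — the energy floor on the frame's tube ball, reference AT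
the track (no drift term in `D`). [folklore chaining: `hcpShifted_boxFloor_W45` + `norm_map_sub_le_of_ball`] -/
theorem hcpEnergy_of_ballLeaves_signed (B : Finset (Fin 3 → ℤ)) (Zb : (E3 →L[ℝ] E3) → Prop) (σ : (E3 →L[ℝ] E3) → E3) {r lam G V₀ : ℝ}
    (hG₀ : 0 ≤ G) (SA : (E3 →L[ℝ] E3) → ℝ)
    (hval : ∀ U : E3 →L[ℝ] E3, Zb U → ‖U - 1‖ ≤ 1 / 4 → ‖σ U‖ ≤ 1 / 4 →
      V₀ ≤ SA U + ∑ b ∈ B, effPot w₄₅ ω₄ (3 / 400) ‖latPt U hexFrame b + U (hcpShift + σ U)‖)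
    (hslope : ∀ (U : E3 →L[ℝ] E3) (ξ : E3), Zb U → ‖U - 1‖ ≤ 1 / 4 → ‖σ U‖ ≤ 1 / 4 →
      |∑ b ∈ B, segG (deriv (effPot w₄₅ ω₄ (3 / 400))) (latPt U hexFrame b + U (hcpShift + σ U)) (U (ξ - σ U)) 0| ≤ G * ‖U (ξ - σ U)‖)
    (hcurv : ∀ (U : E3 →L[ℝ] E3) (ξ : E3), Zb U → ‖U - 1‖ ≤ 1 / 4 → ‖σ U‖ ≤ 1 / 4 → ‖ξ - σ U‖ ≤ r → ‖ξ‖ ≤ 1 / 4 →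
      ∀ s ∈ Set.Ioo (0 : ℝ) 1, (∀ b ∈ B, segR (latPt U hexFrame b + U (hcpShift + σ U)) (U (ξ - σ U)) s ∉ junctions) →
      lam * ‖U (ξ - σ U)‖ ^ 2 ≤ ∑ b ∈ B, segGd (deriv (effPot w₄₅ ω₄ (3 / 400))) (latPt U hexFrame b + U (hcpShift + σ U)) (U (ξ - σ U)) s)
    (U : E3 →L[ℝ] E3) (hZ : Zb U) (hU : ‖U - 1‖ ≤ 1 / 4) (hσ : ‖σ U‖ ≤ 1 / 4) (ξ : E3) (hξ : ‖ξ - σ U‖ ≤ r) (hn : ‖ξ‖ ≤ 1 / 4) :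
    V₀ - G * (5 / 4 * r) + min lam 0 / 2 * (5 / 4 * r) ^ 2 ≤ SA U + ∑ b ∈ B, effPot w₄₅ ω₄ (3 / 400) ‖latPt U hexFrame b + U (hcpShift + ξ)‖ := by
  have hV := hval U hZ hU hσ
  have hV' : V₀ - SA U ≤ ∑ b ∈ B, Wrec ‖latPt U hexFrame b + U (hcpShift + σ U)‖ := by
    unfold Wrec; linarith
  have hD := norm_map_sub_le_of_ball hU hξ
  have key := hcpShifted_boxFloor_W45 B hU hσ hn hG₀ (hcurv U ξ hZ hU hσ hξ hn) hV' (hslope U ξ hZ hU hσ) hD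
  unfold Wrec at key
  linarith

/-! ## §6. Numeric witnesses of the budget (record tube radius `r = 3/400`, `m = 1/625`; census LOEW49 §2 near sample) -/

/-- ζ-centred diameter `D = (5/4)·(3/400) = 3/320`; at `|λ| = 231/200` (frame N03 of LOEW49 §2: plain `2⁻⁸` near floor `−0.155` plus a far-tail
allowance `τ = 1`, FAR-TAIL-47) the curvature loss `|λ|D²/2 ≈ 5.1·10⁻⁵` is below `0.032 m` — far under N03's margin `0.3 m = 4.8·10⁻⁴`. [arithmetic] -/
example : (231 / 200 : ℝ) / 2 * (5 / 4 * (3 / 400)) ^ 2 < 32 / 1000 * (1 / 625) := by norm_num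

/-- Fixed-reference diameter with drift `r₀ = 3/1000`: `D = (5/4)(3/400 + 3/1000)`, loss at `|λ| = 231/200` still `< 0.063 m`. [arithmetic] -/
example : (231 / 200 : ℝ) / 2 * (5 / 4 * (3 / 400 + 3 / 1000)) ^ 2 < 63 / 1000 * (1 / 625) := by norm_num

/-- The BINDING term is `G·D`: the slope budget of the tightest near frame N03 (margin `0.3 m`) at `λ = −231/200`, ζ-centred, is `G ≤ 9/200 = 0.045`
(`G·D + |λ|D²/2 ≤ 0.3 m`), while `G = 1/20` already breaks it. [arithmetic] -/
example : (9 / 200 : ℝ) * (5 / 4 * (3 / 400)) + (231 / 200) / 2 * (5 / 4 * (3 / 400)) ^ 2 ≤ 3 / 10 * (1 / 625) ∧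
    ¬ ((1 / 20 : ℝ) * (5 / 4 * (3 / 400)) + (231 / 200) / 2 * (5 / 4 * (3 / 400)) ^ 2 ≤ 3 / 10 * (1 / 625)) := by
  constructor <;> norm_num

/-- In the near zone the box floor BEATS complete-the-square even where `λ > 0` is certified: at the LOEW ×8 reading `λ = 3/5` and slope `G = 9/200`
the tree floor loses `G²/(2λ) ≈ 1.05 m > 0.3 m` (fails the frame) while the box floor loses `G·D ≈ 0.26 m < 0.3 m` (passes). [arithmetic] -/
example : 3 / 10 * (1 / 625) < (9 / 200 : ℝ) ^ 2 / (2 * (3 / 5)) ∧ (9 / 200 : ℝ) * (5 / 4 * (3 / 400)) < 3 / 10 * (1 / 625) := by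
  constructor <;> norm_num

end Summit.AtomisticToContinuum.Crystallization.Theorems.FrustratedLawDichotomyStrainedPatchHomSignedWell

end
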